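import Summits.MatrixMultiplication.OmegaCensus.HeisenbergPattern

/-!
# ω-census, family (b3): conjecture C9 on the HEISENBERG FAMILY — `Heis p` is not box-useful for every odd `p ≥ 3`

HONEST FRAMING (pub-omega census; verbatim): lottery ticket; floor = certified bounds/negative ranges.
Census BOOKKEEPING (conjecture C9 of the cell; pub-omega stpp-1 gen 19).  THE CONSTRUCTION (uniform in odd `p`): one planar box
`Dunif p` of `Heis p` for every `p` — `Y = {1, ⟨1,0,0⟩, ⟨1,A,0⟩}`, `W = {1, ⟨2,1,0⟩, ⟨0,r,0⟩}` with `A = (p+1)/2` (so `2A = 1`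
in `ZMod p`) and `r = ⌊(3p+1)/8⌋` — whose symplectic data are `det(u₁,u₂) = A ≈ p/2`, `det(v₁,v₂) = 2r ≈ 3p/4`,
`det(u_i,v₁) ∈ {1, 0}`, `det(u_i,v₂) = r ≈ 3p/8` (the Plücker relation `A·2r = 1·r − r·0` holds exactly); and the nine
HEIGHT INTERVALS (`loN`, `lenN`; in units of `p`: columns `(1,0),(2,0)` on `[0,¼)`, `(0,1),(0,2),(1,2),(2,2)` on `[¼,½)`,
`(0,0)` on `[½,¾)`, `(1,1),(2,1)` on `[¾,1)`, with `O(1)` trims), total `6r − 3 ≈ (9/4)p` heights per `(a,b)`-class.  The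
pattern is independent for every odd `p ≥ 3` (`patIndep_Tunif`: per column pair the forbidden difference `tauZ` misses the
difference set of the two intervals — `7 × 81` linear integer facts, `omega`), so by the pattern lemma (`HeisenbergPattern`)
`α(Heis p; p³,3,3) ≥ (6r−3)·p² ≥ (9/5)p³` for odd `p ≥ 5`, `p ∉ {7, 9}`; the three small cases `p = 3, 7, 9` use the same box
with explicit optimal patterns of `6, 14, 18` heights (`decide`).  MAIN: `not_boxUseful_heis_odd : Odd p → 3 ≤ p →
¬ BoxUseful (Heis p)` — an infinite family of groups of centre index `p²`, every proper section of which (for prime `p`) is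
abelian, none box-useful, as C9 (b) predicts; and asymptotically box ratio `≥ 9/4 − O(1/p)`, the value of `A₄`.
Lifted forms `…_of_surjective_heis`, `…_of_injective_heis`.  Nothing here is progress on `ω`.
-/

namespace Summit.MatrixMultiplication.OmegaCensus

open Finset ProductBoxBound

namespace Heis

variable {p : ℕ}

/-! ### The uniform box -/

/-- `A = (p+1)/2`, the inverse of `2` mod odd `p`. [folklore] -/
def hA (p : ℕ) : ℕ := (p + 1) / 2

/-- `r = ⌊(3p+1)/8⌋ ≈ 3p/8`. [folklore] -/
def rr (p : ℕ) : ℕ := (3 * p + 1) / 8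

/-- `a`-coordinates of `y₀, y₁, y₂`: `0, 1, 1`. [folklore] -/
def aN : Fin 3 → ℕ := ![0, 1, 1]
/-- `b`-coordinates of `y₀, y₁, y₂`: `0, 0, A`. [folklore] -/
def bN (p : ℕ) : Fin 3 → ℕ := ![0, 0, hA p]
/-- `a`-coordinates of `w₀, w₁, w₂`: `0, 2, 0`. [folklore] -/
def mN : Fin 3 → ℕ := ![0, 2, 0]
/-- `b`-coordinates of `w₀, w₁, w₂`: `0, 1, r`. [folklore] -/
def nN (p : ℕ) : Fin 3 → ℕ := ![0, 1, rr p]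

/-- The uniform planar box of `Heis p`. [folklore] -/
def Dunif (p : ℕ) : PlanarBox p :=
  ⟨fun i => (aN i : ZMod p), fun i => (bN p i : ZMod p), fun j => (mN j : ZMod p), fun j => (nN p j : ZMod p)⟩

/-- The forbidden differences of the uniform box as integers (same polynomial as `PlanarBox.tau`). [folklore] -/
def tauZ (p : ℕ) (c c' : Fin 3 × Fin 3) : ℤ :=
  ((aN c.1 : ℤ) * (bN p c'.1 : ℤ) - (bN p c.1 : ℤ) * (aN c'.1 : ℤ))
    + ((mN c.2 : ℤ) * (nN p c'.2 : ℤ) - (nN p c.2 : ℤ) * (mN c'.2 : ℤ))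
    + ((aN c.1 : ℤ) - (aN c'.1 : ℤ)) * (nN p c'.2 : ℤ) + ((mN c.2 : ℤ) - (mN c'.2 : ℤ)) * (bN p c.1 : ℤ)

/-- `tau` of the uniform box is the cast of `tauZ`. [folklore] -/
theorem tau_Dunif (c c' : Fin 3 × Fin 3) : (Dunif p).tau c c' = ((tauZ p c c' : ℤ) : ZMod p) := by
  simp only [PlanarBox.tau, Dunif, tauZ]
  push_cast
  ring

/-- The uniform box is nondegenerate for odd `p ≥ 3`. [folklore] -/
theorem nondeg_Dunif (hp : p % 2 = 1) (h3 : 3 ≤ p) : (Dunif p).Nondeg := by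
  -- a natural number strictly between `0` and `p` is nonzero in `ZMod p`
  have hcast : ∀ n : ℕ, 0 < n → n < p → (n : ZMod p) ≠ 0 := fun n h0 hn e =>
    absurd (Nat.le_of_dvd h0 ((ZMod.natCast_eq_zero_iff n p).1 e)) (by omega)
  have h1 : (1 : ZMod p) ≠ 0 := by have := hcast 1 (by omega) (by omega); simpa using this
  have h2 : (2 : ZMod p) ≠ 0 := by have := hcast 2 (by omega) (by omega); simpa using this
  have hA0 : ((hA p : ℕ) : ZMod p) ≠ 0 := hcast _ (by unfold hA; omega) (by unfold hA; omega)
  have hr0 : ((rr p : ℕ) : ZMod p) ≠ 0 := hcast _ (by unfold rr; omega) (by unfold rr; omega)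
  have h1' : (0 : ZMod p) ≠ 1 := h1.symm
  have h2' : (0 : ZMod p) ≠ 2 := h2.symm
  have hA0' : (0 : ZMod p) ≠ (hA p : ℕ) := hA0.symm
  have hr0' : (0 : ZMod p) ≠ (rr p : ℕ) := hr0.symm
  constructor
  · intro i j h
    have ha := congrArg Heis.a h
    have hb := congrArg Heis.b h
    fin_cases i <;> fin_cases j <;>
      simp [PlanarBox.yEl, Dunif, aN, bN, h1, h1', hA0, hA0'] at ha hb ⊢
  · intro i j h
    have ha := congrArg Heis.a h
    have hb := congrArg Heis.b h
    fin_cases i <;> fin_cases j <;>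
      simp [PlanarBox.wEl, Dunif, mN, nN, h2, h2', hr0, hr0'] at ha hb ⊢

/-! ### The uniform pattern: nine height intervals -/

/-- Interval starts `lo(i,j)` (`q₁ = p − 2r`): rows `i`, columns `j`. [folklore] -/
def loN (p : ℕ) : Fin 3 → Fin 3 → ℕ :=
  ![![hA p - 1, p - 2 * rr p, p - 2 * rr p],
    ![0, hA p + 1 + (p - 2 * rr p), p - 2 * rr p],
    ![0, hA p + 1 + (p - 2 * rr p), p - 2 * rr p]]

/-- Interval lengths `len(i,j)` (`q₁ = p − 2r`, `d = 2r − A`). [folklore] -/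
def lenN (p : ℕ) : Fin 3 → Fin 3 → ℕ :=
  ![![p - 2 * rr p + 1, 2 * rr p - hA p, 2 * rr p - hA p],
    ![p - 2 * rr p, 2 * rr p - hA p - 1, 2 * rr p - hA p],
    ![p - 2 * rr p, 2 * rr p - hA p, 2 * rr p - hA p]]

/-- Every interval has length `≤ p` (for `p ≥ 3`). [folklore] -/
theorem lenN_le (h3 : 3 ≤ p) (i j : Fin 3) : lenN p i j ≤ p := by
  fin_cases i <;> fin_cases j <;> simp [lenN, hA, rr] <;> omega

/-- The heights of column `(i,j)`: `lo + k`, `k < len`, cast to `ZMod p`. [folklore] -/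
def colSet (p : ℕ) (c : Fin 3 × Fin 3) : Finset ((Fin 3 × Fin 3) × ZMod p) :=
  (range (lenN p c.1 c.2)).image fun k => (c, ((loN p c.1 c.2 + k : ℕ) : ZMod p))

/-- The uniform pattern: the union of the nine columns. [folklore] -/
def Tunif (p : ℕ) : Finset ((Fin 3 × Fin 3) × ZMod p) :=
  univ.biUnion (colSet p)

/-- Membership in the uniform pattern. [folklore] -/
theorem mem_Tunif {a : (Fin 3 × Fin 3) × ZMod p} :
    a ∈ Tunif p ↔ ∃ (i j : Fin 3) (k : ℕ), k < lenN p i j ∧ a = ((i, j), ((loN p i j + k : ℕ) : ZMod p)) := by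
  constructor
  · intro ha
    obtain ⟨c, -, hc⟩ := mem_biUnion.1 ha
    obtain ⟨k, hk, rfl⟩ := mem_image.1 hc
    exact ⟨c.1, c.2, k, mem_range.1 hk, rfl⟩
  · rintro ⟨i, j, k, hk, rfl⟩
    exact mem_biUnion.2 ⟨(i, j), mem_univ _, mem_image.2 ⟨k, mem_range.2 hk, rfl⟩⟩

/-- Casts of naturals closer than `p` agree only if the naturals agree. [folklore] -/
theorem natCast_eq_natCast_of_lt {a b : ℕ} (h : (a : ZMod p) = b) (hab : a < b + p) (hba : b < a + p) : a = b := by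
  rw [ZMod.natCast_eq_natCast_iff, Nat.modEq_iff_dvd] at h
  have := Int.eq_zero_of_dvd_of_natAbs_lt_natAbs h (by omega)
  omega

/-- Each column contributes exactly `len` heights (`p ≥ 3`). [folklore] -/
theorem card_colSet (h3 : 3 ≤ p) (c : Fin 3 × Fin 3) : #(colSet p c) = lenN p c.1 c.2 := by
  rw [colSet, card_image_of_injOn, card_range]
  intro k hk k' hk' e
  simp only [coe_range, Set.mem_Iio] at hk hk'
  simp only [Prod.mk.injEq, true_and] at e
  have hl := lenN_le h3 c.1 c.2
  have := natCast_eq_natCast_of_lt e (by omega) (by omega)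
  omega

/-- The uniform pattern has `∑ len` entries. [folklore] -/
theorem card_Tunif (h3 : 3 ≤ p) : #(Tunif p) = ∑ i : Fin 3, ∑ j : Fin 3, lenN p i j := by
  rw [Tunif, card_biUnion]
  · rw [← univ_product_univ, sum_product]
    exact sum_congr rfl fun i _ => sum_congr rfl fun j _ => card_colSet h3 (i, j)
  · intro c _ c' _ hcc'
    rw [Function.onFun, disjoint_left]
    intro a ha ha'
    obtain ⟨k, -, rfl⟩ := mem_image.1 ha
    obtain ⟨k', -, e⟩ := mem_image.1 ha'
    exact hcc' (congrArg Prod.fst e).symm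

/-- **The count**: `9p ≤ 5·#Tunif` for odd `p ≥ 5`, `p ∉ {7, 9}` (`#Tunif = 6r − 3`). [folklore] -/
theorem card_Tunif_bound (hp : p % 2 = 1) (h5 : 5 ≤ p) (h7 : p ≠ 7) (h9 : p ≠ 9) : 9 * p ≤ 5 * #(Tunif p) := by
  rw [card_Tunif (by omega)]
  simp only [Fin.sum_univ_three, lenN, hA, rr, Matrix.cons_val_zero, Matrix.cons_val_one, Matrix.cons_val_two,
    Matrix.head_cons, Matrix.tail_cons]
  rcases (by omega : p % 8 = 1 ∨ p % 8 = 3 ∨ p % 8 = 5 ∨ p % 8 = 7) with h8 | h8 | h8 | h8 <;> omega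

/-- Multiples of `p` of absolute value `< 4p`. [folklore] -/
theorem eq_mul_of_dvd_of_lt {e : ℤ} (h : (p : ℤ) ∣ e) (h1 : -(4 * (p : ℤ)) < e) (h2 : e < 4 * p) :
    ∃ t : ℤ, e = p * t ∧ -3 ≤ t ∧ t ≤ 3 := by
  obtain ⟨t, rfl⟩ := h
  have hp : (0 : ℤ) ≤ p := Int.natCast_nonneg p
  refine ⟨t, rfl, ?_, ?_⟩
  · by_contra ht
    have : (p : ℤ) * t ≤ p * (-4) := Int.mul_le_mul_of_nonneg_left (by omega) hp
    omega
  · by_contra ht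
    have : (p : ℤ) * 4 ≤ p * t := Int.mul_le_mul_of_nonneg_left (by omega) hp
    omega

/-- Sizes: `lo + len ≤ p + 1` and `|tauZ| < 3p` (`p ≥ 3`). [folklore] -/
theorem lo_add_len_le (h3 : 3 ≤ p) (i j : Fin 3) : loN p i j + lenN p i j ≤ p + 1 := by
  fin_cases i <;> fin_cases j <;> simp [loN, lenN, hA, rr] <;> omega

/-- `|tauZ| < 3p` (`p ≥ 3`). [folklore] -/
theorem abs_tauZ_lt (h3 : 3 ≤ p) (c c' : Fin 3 × Fin 3) : -(3 * (p : ℤ)) < tauZ p c c' ∧ tauZ p c c' < 3 * p := by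
  obtain ⟨i, j⟩ := c
  obtain ⟨i', j'⟩ := c'
  fin_cases i <;> fin_cases j <;> fin_cases i' <;> fin_cases j' <;> simp [tauZ, aN, bN, mN, nN, hA, rr] <;> omega

set_option maxHeartbeats 4000000 in
/-- **Independence of the uniform pattern** (every odd `p ≥ 3`): no ordered pair of distinct entries sits at a forbidden
height difference — per column pair, the multiple of `p` nearest to `lo + k − lo' − k' − tauZ` is excluded by linear
arithmetic (`omega`). [folklore] -/
theorem patIndep_Tunif (hp : p % 2 = 1) (h3 : 3 ≤ p) : (Dunif p).PatIndep (Tunif p) := by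
  intro a ha b hb hab heq
  obtain ⟨i, j, k, hk, rfl⟩ := mem_Tunif.1 ha
  obtain ⟨i', j', k', hk', rfl⟩ := mem_Tunif.1 hb
  have hne : ((i, j) : Fin 3 × Fin 3) ≠ (i', j') ∨ k ≠ k' := by
    by_contra hcon
    push Not at hcon
    obtain ⟨hc, hkk⟩ := hcon
    simp only [Prod.mk.injEq] at hc
    obtain ⟨rfl, rfl⟩ := hc
    subst hkk
    exact hab rfl
  rw [tau_Dunif] at heq
  have hdvd : (p : ℤ) ∣ ((loN p i j + k : ℕ) : ℤ) - ((loN p i' j' + k' : ℕ) : ℤ) - tauZ p (i, j) (i', j') := by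
    rw [← ZMod.intCast_zmod_eq_zero_iff_dvd]
    push_cast at heq ⊢
    linear_combination heq
  have hb1 := lo_add_len_le h3 i j
  have hb2 := lo_add_len_le h3 i' j'
  have hb3 := abs_tauZ_lt h3 (i, j) (i', j')
  obtain ⟨t, ht, ht1, ht2⟩ := eq_mul_of_dvd_of_lt hdvd (by push_cast; omega) (by push_cast; omega)
  clear hab heq hdvd ha hb hb3
  fin_cases i <;> fin_cases j <;> fin_cases i' <;> fin_cases j' <;>
    simp [loN, lenN, tauZ, aN, bN, mN, nN, hA, rr] at hk hk' hne ht hb1 hb2 <;> interval_cases t <;> omega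

/-- **`Heis p` is not box-useful for odd `p ≥ 5`, `p ∉ {7, 9}`** (uniform pattern). [folklore] -/
theorem not_boxUseful_heis_unif [NeZero p] (hp : p % 2 = 1) (h5 : 5 ≤ p) (h7 : p ≠ 7) (h9 : p ≠ 9) :
    ¬ BoxUseful (Heis p) :=
  (Dunif p).not_boxUseful_of_pattern (nondeg_Dunif hp (by omega)) (patIndep_Tunif hp (by omega))
    (card_Tunif_bound hp h5 h7 h9)

/-! ### The three small cases `p = 3, 7, 9` (same box, explicit optimal patterns) -/

/-- An optimal pattern for `p = 3`: `6 = 2·3` heights. [folklore] -/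
def T3 : Finset ((Fin 3 × Fin 3) × ZMod 3) :=
  {((0, 1), 0), ((1, 1), 0), ((1, 2), 0), ((2, 0), 2), ((2, 1), 2), ((2, 2), 0)}

/-- An optimal pattern for `p = 7`: `14 = 2·7` heights. [folklore] -/
def T7 : Finset ((Fin 3 × Fin 3) × ZMod 7) :=
  {((0, 0), 1), ((0, 1), 4), ((0, 1), 5), ((0, 2), 6), ((1, 1), 3), ((1, 2), 4), ((1, 2), 5), ((2, 0), 2), ((2, 0), 3),
    ((2, 1), 0), ((2, 1), 1), ((2, 2), 4), ((2, 2), 5), ((2, 2), 6)}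

/-- An optimal pattern for `p = 9`: `18 = 2·9` heights. [folklore] -/
def T9 : Finset ((Fin 3 × Fin 3) × ZMod 9) :=
  {((0, 0), 0), ((0, 1), 6), ((0, 1), 7), ((0, 1), 8), ((0, 2), 6), ((0, 2), 7), ((0, 2), 8), ((1, 0), 5), ((1, 2), 6),
    ((1, 2), 7), ((2, 0), 3), ((2, 0), 4), ((2, 0), 5), ((2, 1), 2), ((2, 1), 3), ((2, 2), 6), ((2, 2), 7), ((2, 2), 8)}

/-- **`Heis 3` is not box-useful** (`5·6·9 = 270 ≥ 243 = 9·27`; `α(Heis 3) = 54 = 2·27`). [folklore] -/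
theorem not_boxUseful_heis3 : ¬ BoxUseful (Heis 3) :=
  (Dunif 3).not_boxUseful_of_pattern (T := T3) (nondeg_Dunif rfl le_rfl) (by decide +kernel) (by decide +kernel)

/-- **`Heis 7` is not box-useful** (`5·14 = 70 ≥ 63`). [folklore] -/
theorem not_boxUseful_heis7 : ¬ BoxUseful (Heis 7) :=
  (Dunif 7).not_boxUseful_of_pattern (T := T7) (nondeg_Dunif rfl (by norm_num)) (by decide +kernel) (by decide +kernel)

/-- **`Heis 9` is not box-useful** (`5·18 = 90 ≥ 81`). [folklore] -/
theorem not_boxUseful_heis9 : ¬ BoxUseful (Heis 9) :=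
  (Dunif 9).not_boxUseful_of_pattern (T := T9) (nondeg_Dunif rfl (by norm_num)) (by decide +kernel) (by decide +kernel)

/-! ### Assembly: every odd `p ≥ 3` -/

/-- A uniform pattern statement: for every odd `p ≥ 3` the box `Dunif p` carries an independent pattern `T` with
`9p ≤ 5·#T`. [folklore] -/
theorem exists_pattern_odd (hp : p % 2 = 1) (h3 : 3 ≤ p) :
    ∃ T : Finset ((Fin 3 × Fin 3) × ZMod p), (Dunif p).PatIndep T ∧ 9 * p ≤ 5 * #T := by
  rcases (by omega : p = 3 ∨ p = 7 ∨ p = 9 ∨ (5 ≤ p ∧ p ≠ 7 ∧ p ≠ 9)) with rfl | rfl | rfl | ⟨h5, h7, h9⟩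
  · exact ⟨T3, by decide +kernel, by decide +kernel⟩
  · exact ⟨T7, by decide +kernel, by decide +kernel⟩
  · exact ⟨T9, by decide +kernel, by decide +kernel⟩
  · exact ⟨Tunif p, patIndep_Tunif hp (by omega), card_Tunif_bound hp h5 h7 h9⟩

/-- **MAIN.  `Heis p` is not box-useful for every odd `p ≥ 3`.** [folklore] -/
theorem not_boxUseful_heis_odd [NeZero p] (hp : Odd p) (h3 : 3 ≤ p) : ¬ BoxUseful (Heis p) := by
  obtain ⟨T, hT, hbig⟩ := exists_pattern_odd (Nat.odd_iff.1 hp) h3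
  exact (Dunif p).not_boxUseful_of_pattern (nondeg_Dunif (Nat.odd_iff.1 hp) h3) hT hbig

/-- Witness form: for odd `p ≥ 3`, a `3 × 3` box of `Heis p` with an independent cell set `I`, `9·|Heis p| ≤ 5·#I`. [folklore] -/
theorem exists_indep_odd [NeZero p] (hp : Odd p) (h3 : 3 ≤ p) :
    ∃ (Y W : Finset (Heis p)) (I : Finset (Heis p × Heis p × Heis p)),
      #Y = 3 ∧ #W = 3 ∧ I ⊆ univ ×ˢ (Y ×ˢ W) ∧ (∀ P ∈ I, ∀ P' ∈ I, P ≠ P' → cellWord P P' ≠ 1) ∧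
        9 * Fintype.card (Heis p) ≤ 5 * #I := by
  obtain ⟨T, hT, hbig⟩ := exists_pattern_odd (Nat.odd_iff.1 hp) h3
  obtain ⟨Y, W, I, hY, hW, hI, hind, hcard⟩ :=
    (Dunif p).exists_indep_of_pattern (nondeg_Dunif (Nat.odd_iff.1 hp) h3) hT
  refine ⟨Y, W, I, hY, hW, hI, hind, ?_⟩
  rw [hcard, Heis.card]
  calc 9 * (p * (p * p)) = (9 * p) * (p * p) := by ring
    _ ≤ (5 * #T) * (p * p) := Nat.mul_le_mul_right _ hbig
    _ = 5 * (#T * (p * p)) := by ring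

/-- **No finite group mapping onto `Heis p` (`p ≥ 3` odd) is box-useful.** [folklore] -/
theorem not_boxUseful_of_surjective_heis [NeZero p] (hp : Odd p) (h3 : 3 ≤ p) {G : Type*} [Group G] [Fintype G]
    [DecidableEq G] (f : G →* Heis p) (hf : Function.Surjective f) : ¬ BoxUseful G := by
  obtain ⟨Y, W, I, hY, hW, hI, hind, hbig⟩ := exists_indep_odd hp h3
  exact not_boxUseful_of_surjective f hf hY hW hI hind hbig

/-- **No finite group containing `Heis p` (`p ≥ 3` odd) is box-useful.** [folklore] -/
theorem not_boxUseful_of_injective_heis [NeZero p] (hp : Odd p) (h3 : 3 ≤ p) {G : Type*} [Group G] [Fintype G]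
    [DecidableEq G] (f : Heis p →* G) (hf : Function.Injective f) : ¬ BoxUseful G := by
  obtain ⟨Y, W, I, hY, hW, hI, hind, hbig⟩ := exists_indep_odd hp h3
  exact not_boxUseful_of_injective f hf hY hW hI hind hbig

end Heis

end Summit.MatrixMultiplication.OmegaCensus
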